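import Mathlib
import Summits.MatrixMultiplication.MatrixMultiplication.Theses.SnSubsetDichotomy

/-!
# Boundary (load-bearing) analysis of `stub_partnersDisjointOnBand` — line `mover-covering-amgm`,
# crux `JuntaBranch` (stmt-MatrixMultiplication-8304)

The registered stub `stub_partnersDisjointOnBand` of the line `mover-covering-amgm`
(`Cruxes/JuntaBranch/Lines/mover_covering_amgm.lean`) asserts: for `ε, c > 0` and `n ≥ n₀(ε,c)`, in a
TPP triple `(S,T,U)` of `S_n` that is LARGE (`(n!)^{3/2}e^{-c√n} ≤ |S||T||U|`), whose partners `T, U`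
are inclusion-saturated w.r.t. `S`, at an `ε`-super-neutral block `(I → L)` of `S` whose size `t` lies
in the band `[2n^{(1-ε)/2}, c√n/(ε ln n + 2)]`, both partners have pairwise-disjoint source supports on
`L` (no `τ, τ' ∈ T` and `j` with `τ j = L k`, `τ' j = L k'`, `k ≠ k'`).

This file proves that the largeness hypothesis is LOAD-BEARING: the same statement with `Large`
deleted is false (`partnersDisjointOnBand_false_without_large`), even after adding the side
conditions `1 ≤ t ≤ √n` and weakening the conclusion to the middle partner alone
(`partnersDisjointOnBand_false_without_large_strong`).  The witness family is as favourable to the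
line's heuristic ("a blocky `S` puts the movers of `L` into `Q(S)`") as possible: `n = m^8`,
`ε = 1/4`, `c = 8`, `t = 2m^3` (inside the band, `t ≤ √n = m^4`), `S = Stab_pw(L)` the full pointwise
stabiliser of the block (so `S` is PERFECTLY blocky: `S ∩ U_{L→L} = S`, ratio `n^{(t)} > n^{(3/4)t}`),
`T ⊇ {1, (L₀ L₁)}` and `U ⊇ {1}` inclusion-saturated w.r.t. `S` (finite maximality); the TPP holds
because `Q(S) = S` meets `Q({1,(L₀ L₁)}) = {1,(L₀ L₁)}` trivially, and the transposition `(L₀ L₁) =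
(L₀ L₁)·1⁻¹ ∈ Q(T)` is a mover of `L`.  Consequence for the line: nothing in the stub's hypotheses
other than `Large` constrains the partners at `S`'s block — TPP, saturation, the bump and the band
are jointly consistent with a mover in `Q(T)` — so any proof must extract partner structure from
near-extremal volume alone, for which no mechanism exists (and no `Large(c)` family is known for any
fixed `c`, so the stub is also irrefutable today).  Companion of the standing disprover's
`juntaBranch_false_without_*` lemmas for the crux itself.
-/

open Literature.Combinatorics.Additive
open scoped Classical

set_option linter.dupNamespace false

namespace Summit.MatrixMultiplication.MatrixMultiplication.Theorems.JuntaBranch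

/-- Partner saturation w.r.t. a fixed first set (finite maximality): every TPP triple `(S,T,U)`
extends to `(S,T',U')`, `T ⊆ T'`, `U ⊆ U'`, TPP, with `T'` and `U'` inclusion-maximal.
[folklore] -/
theorem exists_partnerSaturated {n : ℕ} (S T U : Finset (Equiv.Perm (Fin n)))
    (h : TripleProductProperty S T U) :
    ∃ T' U' : Finset (Equiv.Perm (Fin n)), T ⊆ T' ∧ U ⊆ U' ∧ TripleProductProperty S T' U' ∧
      (∀ g ∉ T', ¬ TripleProductProperty S (insert g T') U') ∧
      (∀ g ∉ U', ¬ TripleProductProperty S T' (insert g U')) := by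
  obtain ⟨T', hTT', hT'max⟩ :=
    Finite.exists_le_maximal (p := fun T' : Finset (Equiv.Perm (Fin n)) =>
      TripleProductProperty S T' U) h
  obtain ⟨U', hUU', hU'max⟩ :=
    Finite.exists_le_maximal (p := fun U' : Finset (Equiv.Perm (Fin n)) =>
      TripleProductProperty S T' U') hT'max.1
  refine ⟨T', U', hTT', hUU', hU'max.1, ?_, ?_⟩
  · intro g hg hins
    have h1 : TripleProductProperty S (insert g T') U :=
      hins.mono subset_rfl subset_rfl hUU'
    have h2 : insert g T' ≤ T' := hT'max.2 h1 (Finset.subset_insert g T')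
    exact hg (h2 (Finset.mem_insert_self g T'))
  · intro g hg hins
    have h2 : insert g U' ≤ U' := hU'max.2 hins (Finset.subset_insert g U')
    exact hg (h2 (Finset.mem_insert_self g U'))

/-- The pointwise stabiliser of a block `L` together with `{1, τ}` and `{1}` is a TPP triple as soon
as `τ` moves a point of the block: `s s'⁻¹ τ^{±1} = 1` is impossible because `s s'⁻¹` fixes `L k₀`
while `τ (L k₁) = L k₀ ≠ L k₁`. [folklore] -/
theorem tpp_stabilizer_pair_one {n t : ℕ} (L : Fin t → Fin n) (hL : Function.Injective L)
    (k₀ k₁ : Fin t) (hk : k₀ ≠ k₁) :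
    TripleProductProperty
      (Finset.univ.filter (fun σ : Equiv.Perm (Fin n) => ∀ k, σ (L k) = L k))
      ({1, Equiv.swap (L k₀) (L k₁)} : Finset (Equiv.Perm (Fin n)))
      ({1} : Finset (Equiv.Perm (Fin n))) := by
  set τ : Equiv.Perm (Fin n) := Equiv.swap (L k₀) (L k₁) with hτ
  intro s hs s' hs' a ha a' ha' u hu u' hu' hrel
  simp only [Finset.mem_filter, Finset.mem_univ, true_and] at hs hs'
  simp only [Finset.mem_insert, Finset.mem_singleton] at ha ha' hu hu'
  subst hu
  subst hu'
  have hq : s * s'⁻¹ * (a * a'⁻¹) = 1 := by simpa using hrel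
  have hs'inv : s'⁻¹ (L k₀) = L k₀ := by
    rw [Equiv.Perm.inv_eq_iff_eq]
    exact (hs' k₀).symm
  have key : a = a' := by
    by_contra hne
    have hτ' : a * a'⁻¹ = τ := by
      rcases ha with rfl | rfl <;> rcases ha' with rfl | rfl
      · exact absurd rfl hne
      · simp [hτ, Equiv.swap_inv]
      · simp
      · exact absurd rfl hne
    rw [hτ'] at hq
    have h1 : (s * s'⁻¹ * τ) (L k₁) = L k₁ := by rw [hq]; simp
    have h2 : (s * s'⁻¹ * τ) (L k₁) = L k₀ := by
      simp only [Equiv.Perm.mul_apply]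
      rw [show τ (L k₁) = L k₀ from Equiv.swap_apply_right _ _, hs'inv, hs k₀]
    exact hk (hL (h2.symm.trans h1))
  subst key
  refine ⟨?_, rfl, rfl⟩
  have h1 : s * s'⁻¹ = 1 := by simpa using hq
  exact mul_inv_eq_one.mp h1

/-- **`stub_partnersDisjointOnBand` is false without `Large` (strong form).**  Even with the extra
side conditions `1 ≤ t ≤ √n` and the conclusion weakened to the middle partner `T` alone, the
statement "TPP + partners saturated w.r.t. `S` + `S` `ε`-super-neutral at a band block `(I→L)` ⇒
the source supports of `T` on `L` are pairwise disjoint" fails for `ε = 1/4`, `c = 8` and infinitely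
many `n` (`n = m^8`, `t = 2m^3`, `S = Stab_pw(L)`, `T ⊇ {1,(L₀ L₁)}` saturated). [folklore] -/
theorem partnersDisjointOnBand_false_without_large_strong :
    ¬ (∀ ε : ℝ, 0 < ε → ∀ c : ℝ, 0 < c → ∃ n₀ : ℕ, ∀ n ≥ n₀,
      ∀ S T U : Finset (Equiv.Perm (Fin n)), TripleProductProperty S T U →
      (∀ g ∉ T, ¬ TripleProductProperty S (insert g T) U) →
      (∀ g ∉ U, ¬ TripleProductProperty S T (insert g U)) →
      ∀ t : ℕ, 1 ≤ t → (t : ℝ) ≤ Real.sqrt (n : ℝ) → 2 * (n : ℝ) ^ ((1 - ε) / 2) ≤ (t : ℝ) →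
      (t : ℝ) ≤ c * Real.sqrt (n : ℝ) / (ε * Real.log (n : ℝ) + 2) →
      ∀ I L : Fin t → Fin n, Function.Injective I → Function.Injective L →
      (n : ℝ) ^ ((1 / 2 + ε) * t) * (S.card : ℝ) <
        ((S.filter (fun σ => ∀ k, σ (I k) = L k)).card : ℝ) * (n.descFactorial t : ℝ) →
      ∀ k k' : Fin t, k ≠ k' → ∀ j : Fin n,
          (∃ τ ∈ T, τ j = L k) → (∃ τ' ∈ T, τ' j = L k') → False) := by
  intro h
  obtain ⟨n₀, hn₀⟩ := h (1 / 4) (by norm_num) 8 (by norm_num)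
  -- parameters: m ≥ max(n₀, 2), n = m^8, t = 2m^3
  obtain ⟨m, hm2, hmn₀⟩ : ∃ m : ℕ, 2 ≤ m ∧ n₀ ≤ m := ⟨max n₀ 2, le_max_right _ _, le_max_left _ _⟩
  obtain ⟨n, hn⟩ : ∃ n : ℕ, n = m ^ 8 := ⟨_, rfl⟩
  obtain ⟨t, ht⟩ : ∃ t : ℕ, t = 2 * m ^ 3 := ⟨_, rfl⟩
  have hm4 : 2 ≤ m ^ 4 := le_trans hm2 (Nat.le_self_pow (by norm_num) m)
  have hm5 : 2 ≤ m ^ 5 := le_trans hm2 (Nat.le_self_pow (by norm_num) m)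
  have h87 : 2 * m ^ 7 ≤ m ^ 8 := by
    calc 2 * m ^ 7 ≤ m * m ^ 7 := Nat.mul_le_mul_right _ hm2
      _ = m ^ 8 := by ring
  have h73 : 2 * m ^ 3 ≤ m ^ 7 := by
    calc 2 * m ^ 3 ≤ m ^ 4 * m ^ 3 := Nat.mul_le_mul_right _ hm4
      _ = m ^ 7 := by ring
  have hn₀n : n₀ ≤ n := by
    rw [hn]
    exact hmn₀.trans (Nat.le_self_pow (by norm_num) m)
  have htn : t ≤ n := by rw [ht, hn]; omega
  have ht2 : 2 ≤ t := by
    rw [ht]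
    have : 1 ≤ m ^ 3 := Nat.one_le_pow _ _ (by omega)
    omega
  have hsub : m ^ 7 ≤ n + 1 - t := by rw [hn, ht]; omega
  -- real-number versions
  have hmR : (2 : ℝ) ≤ (m : ℝ) := by exact_mod_cast hm2
  have hm0 : (0 : ℝ) ≤ (m : ℝ) := by positivity
  have hnR : (n : ℝ) = (m : ℝ) ^ 8 := by rw [hn]; push_cast; ring
  have htR : (t : ℝ) = 2 * (m : ℝ) ^ 3 := by rw [ht]; push_cast; ring
  have hsqrt : Real.sqrt (n : ℝ) = (m : ℝ) ^ 4 := by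
    rw [hnR, show (m : ℝ) ^ 8 = ((m : ℝ) ^ 4) ^ 2 by ring, Real.sqrt_sq (by positivity)]
  have hlog : Real.log (n : ℝ) = 8 * Real.log (m : ℝ) := by
    rw [hnR, Real.log_pow]; push_cast; ring
  have hlogm : Real.log (m : ℝ) ≤ (m : ℝ) - 1 := Real.log_le_sub_one_of_pos (by linarith)
  have hlogm0 : 0 ≤ Real.log (m : ℝ) := Real.log_nonneg (by linarith)
  -- the block L = the first t points, and S = its pointwise stabiliser
  set L : Fin t → Fin n := Fin.castLE htn with hLdef
  have hL : Function.Injective L := Fin.castLE_injective htn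
  set S : Finset (Equiv.Perm (Fin n)) :=
    Finset.univ.filter (fun σ : Equiv.Perm (Fin n) => ∀ k, σ (L k) = L k) with hS
  set k₀ : Fin t := ⟨0, by omega⟩ with hk₀
  set k₁ : Fin t := ⟨1, by omega⟩ with hk₁
  have hk : k₀ ≠ k₁ := by simp [hk₀, hk₁]
  set τ : Equiv.Perm (Fin n) := Equiv.swap (L k₀) (L k₁) with hτ
  -- the TPP triple (S, {1,τ}, {1}) and its partner saturation
  have hTPP₀ : TripleProductProperty S ({1, τ} : Finset (Equiv.Perm (Fin n))) {1} :=
    tpp_stabilizer_pair_one L hL k₀ k₁ hk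
  obtain ⟨T', U', hT, -, hTPP', hsatM, hsatR⟩ := exists_partnerSaturated S {1, τ} {1} hTPP₀
  -- band membership of t
  have hlo : 2 * (n : ℝ) ^ (((1 : ℝ) - 1 / 4) / 2) ≤ (t : ℝ) := by
    rw [hnR, htR, show ((1 : ℝ) - 1 / 4) / 2 = 3 / 8 by norm_num,
      show ((m : ℝ) ^ 8) = (m : ℝ) ^ ((8 : ℕ) : ℝ) by rw [Real.rpow_natCast],
      ← Real.rpow_mul hm0, show ((8 : ℕ) : ℝ) * (3 / 8) = ((3 : ℕ) : ℝ) by norm_num,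
      Real.rpow_natCast]
  have hhi : (t : ℝ) ≤ 8 * Real.sqrt (n : ℝ) / (1 / 4 * Real.log (n : ℝ) + 2) := by
    rw [hsqrt, hlog, htR, le_div_iff₀ (by nlinarith)]
    have h3 : (0 : ℝ) ≤ (m : ℝ) ^ 3 := by positivity
    nlinarith [mul_le_mul_of_nonneg_left hlogm h3]
  have htsqrt : (t : ℝ) ≤ Real.sqrt (n : ℝ) := by
    rw [hsqrt, htR]
    nlinarith [pow_le_pow_left₀ (by norm_num : (0 : ℝ) ≤ 2) hmR 3, sq_nonneg ((m : ℝ))]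
  -- super-neutrality of S at (L → L): S ∩ U_{L→L} = S and n^{(3/4)t} = m^{6t} < m^{7t} ≤ n^{(t)}
  have hSfilter : S.filter (fun σ => ∀ k, σ (L k) = L k) = S := by
    ext σ
    simp [hS]
  have hScard : (0 : ℝ) < (S.card : ℝ) := by
    have h1 : (1 : Equiv.Perm (Fin n)) ∈ S := by simp [hS]
    exact_mod_cast Finset.card_pos.mpr ⟨1, h1⟩
  have hdesc : (m : ℝ) ^ (7 * t) ≤ (n.descFactorial t : ℝ) := by
    have h1 : (n + 1 - t) ^ t ≤ n.descFactorial t := Nat.pow_sub_le_descFactorial n t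
    have h2 : (m ^ 7) ^ t ≤ (n + 1 - t) ^ t := Nat.pow_le_pow_left hsub t
    have h3 : ((m ^ 7) ^ t : ℕ) ≤ n.descFactorial t := h2.trans h1
    have h4 : (((m ^ 7) ^ t : ℕ) : ℝ) ≤ (n.descFactorial t : ℝ) := by exact_mod_cast h3
    rw [← pow_mul] at h4
    push_cast at h4
    exact h4
  have hpow : (n : ℝ) ^ ((1 / 2 + 1 / 4) * (t : ℝ)) = (m : ℝ) ^ (6 * t) := by
    rw [hnR, show ((m : ℝ) ^ 8) = (m : ℝ) ^ ((8 : ℕ) : ℝ) by rw [Real.rpow_natCast],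
      ← Real.rpow_mul hm0,
      show ((8 : ℕ) : ℝ) * ((1 / 2 + 1 / 4) * (t : ℝ)) = ((6 * t : ℕ) : ℝ) by push_cast; ring,
      Real.rpow_natCast]
  have hlt : (m : ℝ) ^ (6 * t) < (m : ℝ) ^ (7 * t) :=
    pow_lt_pow_right₀ (by linarith) (by omega)
  have hSN : (n : ℝ) ^ ((1 / 2 + 1 / 4) * (t : ℝ)) * (S.card : ℝ) <
      ((S.filter (fun σ => ∀ k, σ (L k) = L k)).card : ℝ) * (n.descFactorial t : ℝ) := by
    rw [hSfilter, hpow, mul_comm]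
    exact mul_lt_mul_of_pos_left (hlt.trans_le hdesc) hScard
  -- apply the statement and exhibit the mover (1, τ) at j = L k₀
  have hdisj := hn₀ n hn₀n S T' U' hTPP' hsatM hsatR t (by omega) htsqrt hlo hhi L L hL hL hSN
  refine hdisj k₀ k₁ hk (L k₀) ⟨1, hT (by simp), by simp⟩ ⟨τ, hT (by simp [hτ]), ?_⟩
  simp [hτ]

/-- **`stub_partnersDisjointOnBand` is false without `Large`** — literally the registered stub
signature of line `mover-covering-amgm` (crux `JuntaBranch`, stmt-MatrixMultiplication-8304) with
its largeness hypothesis `(n!)^{3/2}e^{-c√n} ≤ |S||T||U|` deleted: the largeness of the triple is the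
ONLY hypothesis of that stub constraining the partners at the block of `S`. [folklore] -/
theorem partnersDisjointOnBand_false_without_large :
    ¬ (∀ ε : ℝ, 0 < ε → ∀ c : ℝ, 0 < c → ∃ n₀ : ℕ, ∀ n ≥ n₀,
      ∀ S T U : Finset (Equiv.Perm (Fin n)), TripleProductProperty S T U →
      (∀ g ∉ T, ¬ TripleProductProperty S (insert g T) U) →
      (∀ g ∉ U, ¬ TripleProductProperty S T (insert g U)) →
      ∀ t : ℕ, 2 * (n : ℝ) ^ ((1 - ε) / 2) ≤ (t : ℝ) →
      (t : ℝ) ≤ c * Real.sqrt (n : ℝ) / (ε * Real.log (n : ℝ) + 2) →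
      ∀ I L : Fin t → Fin n, Function.Injective I → Function.Injective L →
      (n : ℝ) ^ ((1 / 2 + ε) * t) * (S.card : ℝ) <
        ((S.filter (fun σ => ∀ k, σ (I k) = L k)).card : ℝ) * (n.descFactorial t : ℝ) →
      (∀ k k' : Fin t, k ≠ k' → ∀ j : Fin n,
          (∃ τ ∈ T, τ j = L k) → (∃ τ' ∈ T, τ' j = L k') → False) ∧
        (∀ k k' : Fin t, k ≠ k' → ∀ j : Fin n,
          (∃ τ ∈ U, τ j = L k) → (∃ τ' ∈ U, τ' j = L k') → False)) := by
  intro h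
  refine partnersDisjointOnBand_false_without_large_strong ?_
  intro ε hε c hc
  obtain ⟨n₀, hn₀⟩ := h ε hε c hc
  refine ⟨n₀, ?_⟩
  intro n hn S T U hTPP hsatM hsatR t _ _ hlo hhi I L hI hL hSN
  exact (hn₀ n hn S T U hTPP hsatM hsatR t hlo hhi I L hI hL hSN).1

end Summit.MatrixMultiplication.MatrixMultiplication.Theorems.JuntaBranch
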